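import Summits.QuantumFields.YangMills.Theorems.BalabanUVNodesN09HregOfFibredChartAtRecord
import Literature.MathematicalPhysics.QuantumFieldTheory.Balaban1983to89.Node00.RegSetOfFibredChartOnSupport
import Literature.MathematicalPhysics.QuantumFieldTheory.Balaban1983to89.T4TriangularFibredChart
import Literature.MathematicalPhysics.QuantumFieldTheory.Balaban1983to89.BlockAveragingHaarAC
import Summits.QuantumFields.YangMills.Theorems.BalabanUVNodesN09LiftInvariance29AtRecord

/-!
# NODE N09 [B12] — THE ANALYTIC INCLUSION `hreg` AT THE STAGE-13 RECORD FROM PER-BOND INVERSIONS OF THE AVERAGING OF RECORD IN ITS PRIVATE COORDINATES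
# (the central crossing bonds): the record reading of `T4TriangularFibredChart` + `Node00.RegSetOfFibredChartOnSupport`, composed into dag-n09-w4 g3's door

Cell `pub-ymgap` (YM-PLAN Track A), width seat `pub-ymgap-dag-n09-w6` g3 (D-0149 ∕ R399 width seat 6 of node N09); helper of K1⁷ `StabilityBAtRecordR13SepCoPH` =
stmt-QuantumFields-20542 (`--supports`, `--as helper`, count-neutral).  [I] = [Balaban1987RG1] (CMP 109), [B11] = [Balaban1985Variational].

WHY.  N09's Theorem-3 doors at the Stage-13 record display the analytic inclusion `hreg : ∀ j < K, domAlt_{j+1} ⊆ regSetOfRecord K j ρ_j` ([I] p. 259 «effective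
actions for small fields»).  dag-n09-w6 g2 re-shaped it into DISPLAYED fibred-chart data `(Z, τ, Φ, J, S; hmap, havgΦ, hgc)` of the averaging of record
(`Node00.RegSetOfFibredChart`, `…N09HregOfFibredChartAtRecord`), print's road to which is the substitution (2.10) p. 267 around `V^{(k)}(W)`.  THIS FILE takes the
tree's OWN road: the averaging of record `avOfRecord F N K j = blockAvg expMeanLogSU` ((0.4) p. 253) has PRIVATE COORDINATES — the central crossing bond `β(c)` of
each coarse bond `c` (`BlockAveragingHaarAC.centralBond`; `Ū(c′)` is blind to `U(β c)` for `c′ ≠ c`, `BlockAveragingHaarAC.isLocal_avgFun`; `β` injective) — print's own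
distinguished bond «`(hB)(b₀(c)) = h(c)B(c)`, `LQ̃h = I`» p. 267.  By `T4TriangularFibredChart` (this seat, generic), PER-BOND INVERSIONS of the one-variable maps
`g ↦ Ū′(c)` for `U′ = U[β(c) ↦ g]` (= `BlockAveragingEMLHaarAC.fibreMap` at `pre·g·post`, `avgFun_update_centralBond_self`) on environment-dependent windows — local
inverses `ϑ_c(U,·)` on coarse windows `T_c(U)` with their INVERSE change-of-variables laws against one-bond Haar measure — assemble into a fibred chart of
`fieldMeasure` with fibre space THE FINE CONFIGURATIONS THEMSELVES (`Z := GaugeField (F.P K) j SU(N)`, `τ := fieldMeasure`), `Φ (V, U) = extend β (c ↦ ϑ_c(U, V c)) U`,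
`J (V, U) = 𝟙[∀ c, V c ∈ T_c(U)]·∏_c j_c(U, V c)`, lying over `V` wherever `J ≠ 0`; and by `Node00.RegSetOfFibredChartOnSupport` (this seat) that support form of the
fibre identity suffices for `hreg`.  No Lie algebra, no background, no linearisation, no measurable section of `Ū`.

WHAT IS PROVED (0 def, 0 sorry).  §1 `isLocal_avOfRecord` (standing range by dag-n09-w2's `…N09LiftInvariance29AtRecord.succ_le_range_of_lt`), `centralBond_injective_record`.
§2 ★★ `fieldMeasure_restrict_eq_map_of_perBondCharts` (the record `hmap` from per-bond data), ★ `avOfRecord_triChart_eq_of_jacobian_ne_zero` (the support-form `havgΦ`),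
`measurable_triChart_record`, `measurable_triJacobian_record`.  §3 ★★★ `hreg_of_perBondCharts` — the binder `hreg` of the N09 doors VERBATIM (all `j < P.K`) from the
door's own (I19) `hint` and, per step, per-bond inversion data + the support clause `hS` («where `ρ_j ≠ 0`, every private coordinate lies in its fine window») +
continuity `hgc` of the fibre integral along THIS chart.  §4 ★★★ `thm3Member_stage13SepCoPH_atDomAlt_of_perBondCharts_of_numerics_of_εreg_eq` — dag-n09-w4 g3's door with
`hreg` replaced by that data (via dag-n09-w6 g2's `…_of_numerics_of_εreg_eq` composition pattern).

HONEST FRAMING.  Count-neutral RE-SHAPING of ONE displayed hypothesis, kernel bookkeeping BY NAME; the per-bond inversions (`Ω T ϑ jd` with `hright`, `hlaw`), the support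
clause `hS` and the continuity `hgc` are HYPOTHESES — NOT constructed here (the one-variable (0.4) fibre map's local-diffeomorphism inputs are `T4EMLTangentInjective` ∕
`…N07CentralResponseOnto`; its inversion with the inverse law is the located successor piece); NOTHING of Bałaban's asserted ([B11] Thm 1, (I19) stay hypotheses);
NO carrier re-pointed; A6: no inhabitant at the V18∕V19 witness claimed; N09 NOT discharged; conjunct 1 (Lemma 4) and FLAG №7 untouched; K0⁷∕K1⁷ NOT closed; counts
unmoved (typed 28∕28 · discharged 5∕27); one finite four-torus programme at fixed `ε = L^{−K}` per run — R4 closes the conditional rung `BalabanLadder.UV` only; NOT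
ℝ⁴ ∕ infinite volume ∕ OS; the Yang–Mills mass gap (Clay) is NOT proved by any of this.
-/

noncomputable section

namespace Summit.QuantumFields.YangMills.BalabanUVNodes.N09HregOfPerBondChartsAtRecord

open MeasureTheory Set Function
open scoped ENNReal NNReal
open Literature.MathematicalPhysics.QuantumFieldTheory.Balaban1983to89
open Literature.MathematicalPhysics.QuantumFieldTheory.Balaban1983to89.T4Continuum (T4Family)
open Literature.MathematicalPhysics.QuantumFieldTheory.Balaban1983to89.DagBinding (WorldP leavesP)
open Literature.MathematicalPhysics.QuantumFieldTheory.Balaban1983to89.Node00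
open Literature.MathematicalPhysics.QuantumFieldTheory.Balaban1983to89.BlockAveragingHaarAC (centralBond centralBond_injective isLocal_avgFun)
open Literature.MathematicalPhysics.QuantumFieldTheory.Balaban1983to89.T4TriangularPushforward (IsLocal)
open Literature.MathematicalPhysics.QuantumFieldTheory.Balaban1983to89.T4TriangularFibredChart
open Literature.MathematicalPhysics.QuantumFieldTheory.Balaban1983to89.B12RTGaugeInvariance254 (liftTransf)
open Literature.MathematicalPhysics.QuantumFieldTheory.Balaban1983to89.GaugeField (gaugeAct)
open Literature.MathematicalPhysics.QuantumFieldTheory.Balaban1983to89.ExpMeanLog (deltaSU expMeanLogSU)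
open N09HregOfFibredChartAtRecord (mem_setOf_chi_ne_zero_of_betaInputOfRecord_ne_zero)
open N09B0RiderAtRecord (thm3Member_stage13SepCoPH_atDomAlt_of_numerics_of_εreg_eq)
open N09LiftInvariance29AtRecord (succ_le_range_of_lt)

variable {F : T4Family} {N : ℕ} [NeZero N]

/-! ## §1  The private coordinates of the averaging of record: standing range, locality, injectivity -/

/-- **FACT (A) at the record**: the averaging of record is LOCAL in the central crossing bonds — `Ū(c′)` does not see `U(β c)` for `c′ ≠ c`
(`BlockAveragingHaarAC.isLocal_avgFun` at `ℰ = expMeanLogSU`; `avOfRecord_avg` is `rfl`). [cite: Balaban1987RG1, (0.4) p.253 and p.267] -/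
theorem isLocal_avOfRecord {K j : ℕ} [DecidableEq (PBond (F.P K) j)] (hj : j < K) :
    IsLocal (centralBond : PBond (F.P K) (j + 1) → PBond (F.P K) j)
      ((avOfRecord F N K j).avg : GaugeField (F.P K) j (SU N) → GaugeField (F.P K) (j + 1) (SU N)) :=
  isLocal_avgFun (succ_le_range_of_lt hj) expMeanLogSU

/-- `β = centralBond` is injective at every level `j < K` of the record. [cite: Balaban1987RG1, (0.4) p.253 (bookkeeping)] -/
theorem centralBond_injective_record {K j : ℕ} (hj : j < K) : Injective (centralBond : PBond (F.P K) (j + 1) → PBond (F.P K) j) :=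
  centralBond_injective (succ_le_range_of_lt hj)

/-! ## §2  The record `hmap` and the support-form `havgΦ` from per-bond inversion data -/

section Chart

variable {K j : ℕ} (Ω T : PBond (F.P K) (j + 1) → GaugeField (F.P K) j (SU N) → Set (SU N))
  (ϑ : PBond (F.P K) (j + 1) → GaugeField (F.P K) j (SU N) → SU N → SU N)
  (jd : PBond (F.P K) (j + 1) → GaugeField (F.P K) j (SU N) → SU N → ℝ≥0)

omit [NeZero N] in
/-- The private-coordinate chart of the averaging of record is measurable. [cite: Balaban1987RG1, (2.10) p.267 (bookkeeping)] -/
theorem measurable_triChart_record (hj : j < K) (hθm : ∀ c, Measurable fun p : GaugeField (F.P K) j (SU N) × SU N => ϑ c p.1 p.2) :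
    Measurable fun p : (PBond (F.P K) (j + 1) → SU N) × GaugeField (F.P K) j (SU N) =>
      (extend centralBond (fun c => ϑ c p.2 (p.1 c)) p.2 : GaugeField (F.P K) j (SU N)) :=
  measurable_triChart (ι := PBond (F.P K) j) (G := SU N) ϑ (centralBond_injective_record hj) hθm

omit [NeZero N] in
/-- Its Jacobian is measurable. [cite: Balaban1987RG1, (2.10) p.267 (bookkeeping)] -/
theorem measurable_triJacobian_record (hTm : ∀ c, MeasurableSet {p : GaugeField (F.P K) j (SU N) × SU N | p.2 ∈ T c p.1})
    (hjm : ∀ c, Measurable fun p : GaugeField (F.P K) j (SU N) × SU N => jd c p.1 p.2) :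
    Measurable fun p : (PBond (F.P K) (j + 1) → SU N) × GaugeField (F.P K) j (SU N) =>
      {p : (PBond (F.P K) (j + 1) → SU N) × GaugeField (F.P K) j (SU N) | ∀ c, p.1 c ∈ T c p.2}.indicator
        (fun p => ∏ c, jd c p.2 (p.1 c)) p :=
  measurable_triJacobian (ι := PBond (F.P K) j) (G := SU N) T jd hTm hjm

/-- ★ **THE SUPPORT-FORM FIBRE IDENTITY AT THE RECORD**: wherever the Jacobian is non-zero, the chart lies over the coarse variable, `Ū(Φ(V,U)) = V`.
[cite: Balaban1987RG1, (2.4) p.266 and (2.10) p.267 (bookkeeping: the chart parametrises the fibre)] -/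
theorem avOfRecord_triChart_eq_of_jacobian_ne_zero [DecidableEq (PBond (F.P K) j)] (hj : j < K)
    (hright : ∀ c U, ∀ v ∈ T c U, (avOfRecord F N K j).avg (update U (centralBond c) (ϑ c U v)) c = v)
    {V : PBond (F.P K) (j + 1) → SU N} {U : GaugeField (F.P K) j (SU N)}
    (hJ : {p : (PBond (F.P K) (j + 1) → SU N) × GaugeField (F.P K) j (SU N) | ∀ c, p.1 c ∈ T c p.2}.indicator
      (fun p => ∏ c, jd c p.2 (p.1 c)) (V, U) ≠ 0) :
    (avOfRecord F N K j).avg (extend centralBond (fun c => ϑ c U (V c)) U) = V :=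
  apply_triChart_eq_of_jacobian_ne_zero (ι := PBond (F.P K) j) (G := SU N) T ϑ jd (isLocal_avOfRecord hj)
    (centralBond_injective_record hj) hright hJ

/-- ★★ **THE RECORD `hmap` FROM PER-BOND INVERSION DATA** (`T4TriangularFibredChart.pi_restrict_preimage_inter_eq_map_prod_withDensity` at `μ = ν =` one-bond Haar measure
on `SU(N)`, `A = avOfRecord F N K j`, `β = centralBond`; `fieldMeasure = piHaar = Measure.pi Haar` by `rfl`): for every measurable coarse set `U₀`,
`dU⌊(Ū⁻¹U₀ ∩ {U | ∀ c, U(β c) ∈ Ω_c(U)}) = Φ_*(((dV⌊U₀) ⊗ dU)·J)`. [cite: Balaban1987RG1, (0.4) p.253, (2.4) p.266 and (2.10) p.267 (bookkeeping)] -/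
theorem fieldMeasure_restrict_eq_map_of_perBondCharts [DecidableEq (PBond (F.P K) j)] (hj : j < K)
    (hΩm : ∀ c, MeasurableSet {p : GaugeField (F.P K) j (SU N) × SU N | p.2 ∈ Ω c p.1})
    (hTm : ∀ c, MeasurableSet {p : GaugeField (F.P K) j (SU N) × SU N | p.2 ∈ T c p.1})
    (hθm : ∀ c, Measurable fun p : GaugeField (F.P K) j (SU N) × SU N => ϑ c p.1 p.2)
    (hjm : ∀ c, Measurable fun p : GaugeField (F.P K) j (SU N) × SU N => jd c p.1 p.2)
    (hΩbl : ∀ c (U : GaugeField (F.P K) j (SU N)) (g : PBond (F.P K) (j + 1) → SU N), Ω c (extend centralBond g U) = Ω c U)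
    (hright : ∀ c U, ∀ v ∈ T c U, (avOfRecord F N K j).avg (update U (centralBond c) (ϑ c U v)) c = v)
    (hlaw : ∀ c U, (HaarData.haar : Measure (SU N)).restrict (Ω c U) =
      (((HaarData.haar : Measure (SU N)).restrict (T c U)).withDensity fun v => (jd c U v : ℝ≥0∞)).map (ϑ c U))
    {U₀ : Set (PBond (F.P K) (j + 1) → SU N)} (hU₀ : MeasurableSet U₀) :
    (fieldMeasure (F.P K) j (SU N)).restrict ((avOfRecord F N K j).avg ⁻¹' U₀ ∩ {U | ∀ c, U (centralBond c) ∈ Ω c U}) =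
      ((((piHaar (F.P K) (j + 1) (SU N)).restrict U₀).prod (fieldMeasure (F.P K) j (SU N))).withDensity fun p =>
          (({p : (PBond (F.P K) (j + 1) → SU N) × GaugeField (F.P K) j (SU N) | ∀ c, p.1 c ∈ T c p.2}.indicator
            (fun p => ∏ c, jd c p.2 (p.1 c)) p : ℝ≥0) : ℝ≥0∞)).map
        (fun p : (PBond (F.P K) (j + 1) → SU N) × GaugeField (F.P K) j (SU N) =>
          (extend centralBond (fun c => ϑ c p.2 (p.1 c)) p.2 : GaugeField (F.P K) j (SU N))) :=
  pi_restrict_preimage_inter_eq_map_prod_withDensity (ι := PBond (F.P K) j) (G := SU N) Ω T ϑ jd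
    (HaarData.haar : Measure (SU N)) (HaarData.haar : Measure (SU N)) (isLocal_avOfRecord hj) (centralBond_injective_record hj)
    (avOfRecord_measurable F N K j) hΩm hTm hθm hjm hΩbl hright hlaw hU₀

end Chart

/-! ## §3  The analytic inclusion `hreg` of the N09 doors from per-bond inversion data, all steps -/

/-- ★★★ **`hreg` FROM PER-BOND INVERSIONS OF THE AVERAGING OF RECORD IN ITS PRIVATE COORDINATES.**  For a Stage-13 parameter `θ` and a run `P`, with the β-input
densities `ρ_j = betaInputOfRecord (TβOfRecord₁₃) (chiβOfRecord₁₃ θ) P.K (gOfRecord₁₃ θ P) j`: if (I19) every `ρ_j` is integrable (`hint`, the door's own) and, for every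
step `j < P.K` and every coarse bond `c`, the ONE-VARIABLE MAP `g ↦ Ū′(c)` (`U′ = U[β(c) ↦ g]`) of `avOfRecord F N P.K j` is INVERTED — jointly measurable data: a fine
window `Ω j c U ⊆ SU(N)` blind to the private coordinates of `U`, a coarse window `T j c U`, a local inverse `ϑ j c U` on it (`hright`) with the inverse change-of-variables law
against one-bond Haar measure (`hlaw`) — and if (support clause `hS`) wherever `ρ_j(U) ≠ 0` every private coordinate `U(β c)` lies in its window `Ω j c U`, and (`hgc`) the
fibre integral `V ↦ ∫ J_j(V,U)·ρ_j(Φ_j(V,U)) dU` of the resulting chart is continuous on `domAltOfRecord θ.ν P.K (j+1)` — THEN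
`domAltOfRecord θ.ν P.K (j+1) ⊆ regSetOfRecord F N P.K j ρ_j` for every `j < P.K`: the binder `hreg` of the N09 doors VERBATIM.  The inversions are displayed, not constructed.
[cite: Balaban1987RG1, p.259, (0.4) p.253, (2.10) p.267 and (0.13) p.254] -/
theorem hreg_of_perBondCharts (θ : Stage13Params F N) (P : B12.RunParams) [∀ j, DecidableEq (PBond (F.P P.K) j)]
    (Ω T : ∀ j, PBond (F.P P.K) (j + 1) → GaugeField (F.P P.K) j (SU N) → Set (SU N))
    (ϑ : ∀ j, PBond (F.P P.K) (j + 1) → GaugeField (F.P P.K) j (SU N) → SU N → SU N)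
    (jd : ∀ j, PBond (F.P P.K) (j + 1) → GaugeField (F.P P.K) j (SU N) → SU N → ℝ≥0)
    (hint : ∀ j < P.K, Integrable (betaInputOfRecord F N (TβOfRecord₁₃ F N) (chiβOfRecord₁₃ F N θ) P.K (gOfRecord₁₃ F N θ P) j)
      (fieldMeasure (F.P P.K) j (SU N)))
    (hΩm : ∀ j < P.K, ∀ c, MeasurableSet {p : GaugeField (F.P P.K) j (SU N) × SU N | p.2 ∈ Ω j c p.1})
    (hTm : ∀ j < P.K, ∀ c, MeasurableSet {p : GaugeField (F.P P.K) j (SU N) × SU N | p.2 ∈ T j c p.1})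
    (hθm : ∀ j < P.K, ∀ c, Measurable fun p : GaugeField (F.P P.K) j (SU N) × SU N => ϑ j c p.1 p.2)
    (hjm : ∀ j < P.K, ∀ c, Measurable fun p : GaugeField (F.P P.K) j (SU N) × SU N => jd j c p.1 p.2)
    (hΩbl : ∀ j < P.K, ∀ c (U : GaugeField (F.P P.K) j (SU N)) (g : PBond (F.P P.K) (j + 1) → SU N),
      Ω j c (extend centralBond g U) = Ω j c U)
    (hright : ∀ j < P.K, ∀ c U, ∀ v ∈ T j c U, (avOfRecord F N P.K j).avg (update U (centralBond c) (ϑ j c U v)) c = v)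
    (hlaw : ∀ j < P.K, ∀ c U, (HaarData.haar : Measure (SU N)).restrict (Ω j c U) =
      (((HaarData.haar : Measure (SU N)).restrict (T j c U)).withDensity fun v => (jd j c U v : ℝ≥0∞)).map (ϑ j c U))
    (hS : ∀ j < P.K, ∀ U, betaInputOfRecord F N (TβOfRecord₁₃ F N) (chiβOfRecord₁₃ F N θ) P.K (gOfRecord₁₃ F N θ P) j U ≠ 0 →
      ∀ c, U (centralBond c) ∈ Ω j c U)
    (hgc : ∀ j < P.K, ContinuousOn
      (fun V => ∫ U, (({p : (PBond (F.P P.K) (j + 1) → SU N) × GaugeField (F.P P.K) j (SU N) | ∀ c, p.1 c ∈ T j c p.2}.indicator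
          (fun p => ∏ c, jd j c p.2 (p.1 c)) (V, U) : ℝ≥0) : ℝ) *
        betaInputOfRecord F N (TβOfRecord₁₃ F N) (chiβOfRecord₁₃ F N θ) P.K (gOfRecord₁₃ F N θ P) j
          (extend centralBond (fun c => ϑ j c U (V c)) U) ∂(fieldMeasure (F.P P.K) j (SU N)))
      (domAltOfRecord F N θ.ν P.K (j + 1))) :
    ∀ j < P.K, domAltOfRecord F N θ.ν P.K (j + 1) ⊆ regSetOfRecord F N P.K j
      (betaInputOfRecord F N (TβOfRecord₁₃ F N) (chiβOfRecord₁₃ F N θ) P.K (gOfRecord₁₃ F N θ P) j) := by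
  intro j hj
  exact domAlt_subset_regSetOfRecord_of_fibredChart_of_ne_zero (τ := fieldMeasure (F.P P.K) j (SU N)) θ.ν hj (hint j hj)
    (fun U hU => hS j hj U hU) (measurable_triChart_record (ϑ j) hj (hθm j hj)) (measurable_triJacobian_record (T j) (jd j) (hTm j hj) (hjm j hj))
    (fun V _ U hJ => avOfRecord_triChart_eq_of_jacobian_ne_zero (T j) (ϑ j) (jd j) hj (hright j hj) hJ)
    (fieldMeasure_restrict_eq_map_of_perBondCharts (Ω j) (T j) (ϑ j) (jd j) hj (hΩm j hj) (hTm j hj) (hθm j hj) (hjm j hj) (hΩbl j hj)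
      (hright j hj) (hlaw j hj)
      (IsOpen.measurableSet (α := PBond (F.P P.K) (j + 1) → SU N)
        (B12ContinuousTransportInvarianceOn.isOpen_domAltOfRecord θ.ν P.K (j + 1))))
    (hgc j hj)

/-! ## §4  dag-n09-w4 g3's small-field-bookkeeping door with `hreg` replaced by per-bond inversion data -/

/-- ★★★ **THE N09 THEOREM-3 DOOR AT THE STAGE-13 RECORD WITH `hreg` REPLACED BY PER-BOND INVERSIONS OF THE AVERAGING OF RECORD**
(`…N09B0RiderAtRecord.thm3Member_stage13SepCoPH_atDomAlt_of_numerics_of_εreg_eq` with `hreg := hreg_of_perBondCharts …`): N09's Theorem-3 member from (181)ˢᵒˡ `hcov`,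
`hsolν` + [B11] ×3 at one radius (N07), (I19) `hint`, NUMERICS on the record's letters, and — in place of the analytic inclusion — per-bond inversion data of the (0.4)
one-variable fibre maps in the central crossing bonds + the support clause + the continuity of the fibre integrals.  CONDITIONAL; nothing of Bałaban's asserted; N09 NOT
discharged. [cite: Balaban1987RG1, Thm 3 p.264, p.259, (0.4) p.253, (2.9)–(2.10) pp.266–267; Balaban1985Variational, Thm 1 (8)–(10) p.279 and (181) p.307] -/
theorem thm3Member_stage13SepCoPH_atDomAlt_of_perBondCharts_of_numerics_of_εreg_eq (θ : Stage13HParams F N) (h : θ.Provisos₁₃SepCoPH F N)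
    {w : WorldP} (hC : w.C = (datumOfRecord₁₃SepCoPH F N θ h).C) (P : B12.RunParams) [∀ j, DecidableEq (PBond (F.P P.K) j)]
    (hε : 0 < θ.ε₂₉) (heq : θ.toStage13Params.ν.εreg = θ.εbg)
    (hεreg : 0 < θ.toStage13Params.ν.εreg)
    (hε3 : (143 * (((((F.P P.K).d + 4 : ℕ) : ℝ)) ^ 2 / 4) ^ 2) * θ.toStage13Params.ν.εreg ≤ 1 / 3)
    (hε2 : 2 * θ.toStage13Params.ν.εreg ≤ 2 * deltaSU (Fin N) / ((((F.P P.K).d + 4) * (F.P P.K).L : ℕ) : ℝ) ^ 2)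
    (hord : 2 * θ.toStage13Params.ν.εreg / ((F.P P.K).L : ℝ) ^ 2 +
      4 * max θ.toStage13Params.ε₂₉ (10 * (((((F.P P.K).d + 2) * (F.P P.K).L : ℕ) : ℝ) * θ.toStage13Params.ε₂₉) * ((F.P P.K).L : ℝ) ^ ((F.P P.K).d - 1)) ≤
        θ.toStage13Params.ν.ε₀)
    (hn1 : 1640 * (2 * (((((F.P P.K).d + 2) * (F.P P.K).L : ℕ) : ℝ) * θ.toStage13Params.ε₂₉) +
        ((((F.P P.K).d + 2) * (F.P P.K).L : ℕ) : ℝ) ^ 2 / 4 * (2 * θ.toStage13Params.ν.εreg / ((F.P P.K).L : ℝ) ^ 2)) *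
          (((F.P P.K).L : ℝ) ^ ((F.P P.K).d - 1)) ^ 2 ≤ 1)
    (hn2 : 13 * (2 * (((((F.P P.K).d + 2) * (F.P P.K).L : ℕ) : ℝ) * θ.toStage13Params.ε₂₉) +
        ((((F.P P.K).d + 2) * (F.P P.K).L : ℕ) : ℝ) ^ 2 / 4 * (2 * θ.toStage13Params.ν.εreg / ((F.P P.K).L : ℝ) ^ 2)) *
          ((F.P P.K).L : ℝ) ^ ((F.P P.K).d - 1) < deltaSU (Fin N))
    (hcov : ∀ j < P.K, ∀ (v : GaugeTransf (F.P P.K) (j + 1) (SU N)) (W : GaugeField (F.P P.K) (j + 1) (SU N)),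
      UkExists F N P.K (j + 1) θ.toStage13Params.ν.εreg W →
        critCfgOfRecord F N θ.toStage13Params.ν P.K j (gaugeAct v W) = gaugeAct (liftTransf v) (critCfgOfRecord F N θ.toStage13Params.ν P.K j W))
    (hsolν : ∀ j < P.K, ∀ W ∈ domAltOfRecord F N θ.ν P.K (j + 1), UkExists F N P.K (j + 1) θ.toStage13Params.ν.εreg W)
    (hint : ∀ j < P.K, Integrable (betaInputOfRecord F N (TβOfRecord₁₃ F N) (chiβOfRecord₁₃ F N θ.toStage13Params) P.K (gOfRecord₁₃ F N θ.toStage13Params P) j)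
      (fieldMeasure (F.P P.K) j (SU N)))
    (Ω T : ∀ j, PBond (F.P P.K) (j + 1) → GaugeField (F.P P.K) j (SU N) → Set (SU N))
    (ϑ : ∀ j, PBond (F.P P.K) (j + 1) → GaugeField (F.P P.K) j (SU N) → SU N → SU N)
    (jd : ∀ j, PBond (F.P P.K) (j + 1) → GaugeField (F.P P.K) j (SU N) → SU N → ℝ≥0)
    (hΩm : ∀ j < P.K, ∀ c, MeasurableSet {p : GaugeField (F.P P.K) j (SU N) × SU N | p.2 ∈ Ω j c p.1})
    (hTm : ∀ j < P.K, ∀ c, MeasurableSet {p : GaugeField (F.P P.K) j (SU N) × SU N | p.2 ∈ T j c p.1})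
    (hθm : ∀ j < P.K, ∀ c, Measurable fun p : GaugeField (F.P P.K) j (SU N) × SU N => ϑ j c p.1 p.2)
    (hjm : ∀ j < P.K, ∀ c, Measurable fun p : GaugeField (F.P P.K) j (SU N) × SU N => jd j c p.1 p.2)
    (hΩbl : ∀ j < P.K, ∀ c (U : GaugeField (F.P P.K) j (SU N)) (g : PBond (F.P P.K) (j + 1) → SU N),
      Ω j c (extend centralBond g U) = Ω j c U)
    (hright : ∀ j < P.K, ∀ c U, ∀ v ∈ T j c U, (avOfRecord F N P.K j).avg (update U (centralBond c) (ϑ j c U v)) c = v)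
    (hlaw : ∀ j < P.K, ∀ c U, (HaarData.haar : Measure (SU N)).restrict (Ω j c U) =
      (((HaarData.haar : Measure (SU N)).restrict (T j c U)).withDensity fun v => (jd j c U v : ℝ≥0∞)).map (ϑ j c U))
    (hS : ∀ j < P.K, ∀ U, betaInputOfRecord F N (TβOfRecord₁₃ F N) (chiβOfRecord₁₃ F N θ.toStage13Params) P.K
        (gOfRecord₁₃ F N θ.toStage13Params P) j U ≠ 0 → ∀ c, U (centralBond c) ∈ Ω j c U)
    (hgc : ∀ j < P.K, ContinuousOn
      (fun V => ∫ U, (({p : (PBond (F.P P.K) (j + 1) → SU N) × GaugeField (F.P P.K) j (SU N) | ∀ c, p.1 c ∈ T j c p.2}.indicator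
          (fun p => ∏ c, jd j c p.2 (p.1 c)) (V, U) : ℝ≥0) : ℝ) *
        betaInputOfRecord F N (TβOfRecord₁₃ F N) (chiβOfRecord₁₃ F N θ.toStage13Params) P.K (gOfRecord₁₃ F N θ.toStage13Params P) j
          (extend centralBond (fun c => ϑ j c U (V c)) U) ∂(fieldMeasure (F.P P.K) j (SU N)))
      (domAltOfRecord F N θ.ν P.K (j + 1)))
    (h11 : ∀ k, k ≤ P.K → ∀ V ∈ domAltOfRecord F N θ.ν P.K k, UkExists F N P.K k θ.εbg V ∧ UniqueUkOrbit F N P.K k θ.εbg V)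
    (hres : ∀ k, k ≤ P.K → HRestrict F N θ.εbg P.K k (domAltOfRecord F N θ.ν P.K k))
    (huniq : ∀ k, k ≤ P.K → ∀ V ∈ domAltOfRecord F N θ.ν P.K k, ∀ j < k,
      UniqueUkOrbit F N P.K (j + 1) θ.εbg (Averaging.iter (avOfRecord F N P.K) (j + 1) (Uk F N P.K k θ.εbg V))) :
    (leavesP w P).smallCouplings → (leavesP w P).smallFieldInductive :=
  thm3Member_stage13SepCoPH_atDomAlt_of_numerics_of_εreg_eq θ h hC P hε heq hεreg hε3 hε2 hord hn1 hn2 hcov hsolν hint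
    (hreg_of_perBondCharts θ.toStage13Params P Ω T ϑ jd hint hΩm hTm hθm hjm hΩbl hright hlaw hS hgc) h11 hres huniq

end Summit.QuantumFields.YangMills.BalabanUVNodes.N09HregOfPerBondChartsAtRecord

end
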